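import Summits.BirchSwinnertonDyer.BirchSwinnertonDyer.Theorems.SignedLowerHalvesKobayashiLowerHalfSemistableDefiniteLineUnitLift
import Summits.BirchSwinnertonDyer.BirchSwinnertonDyer.Theorems.PrintCf2RubinValueTwoFourTermMuDefect
import HarnessLib

/-!
# M-LINE-PIN, file 1: pinning a two-variable principal ideal from ONE line (ideal-level and `p`-power forms)

Cell `bsd-print-cf2`, width seat `bsd-line-cf2c-w8` g3 (prover-bsd-line-cf2c-w8-g3-0), planner bsd-print-cf2-plan g19's named
piece M-LINE-PIN (2026-08-29T03:45:29Z) for the DECIDING crux `PrintCf2RubinValueTwo.TwoVariableMainConjAtSplitTwoQuad`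
(stmt-BirchSwinnertonDyer-24033, S3a-quad). `--supports stmt-BirchSwinnertonDyer-24033 --as helper`, Theses-free.
HONEST FRAMING: pure commutative algebra; nothing about elliptic curves, Selmer groups or measures is proved here; no summit
statement is proved by this seat; BSD is not proved by any of this. THEOREMS ONLY (no definition, no named fact, no `sorry`).

THE MECHANISM («squeeze one dimension up»). The element-level lift «`f ∣ g`, `φ` reflects units, `φ f` regular, `φ f ~ φ g` ⟹
`f ~ g`» is ALREADY in the tree (`DefiniteLineUnitLift.associated_of_dvd_of_associated_map`, with both coordinate-line
instances `TwoVarPrimes.isLocalHom_constantCoeff` / `DefiniteLineUnitLift.isLocalHom_mapConstantCoeff`); this file adds only what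
the S3a-quad consumers need and the tree does not have:
* §1 `span_singleton_eq_of_dvd_of_span_map_eq` — the IDEAL-level pin through one units-reflecting ring map into a domain
  (hypothesis and conclusion as equalities of principal ideals, the currency of `Module.charIdeal … = Ideal.span {G}`), and its
  `Ideal.map` form;
* §2 the SCALAR-DEFECT pin `isUnit_map_of_mem_span_mul_of_mem_span` («`g ∈ (c·f)`, `φ f ∈ (φ g)`, `φ f ≠ 0` ⟹ `φ c` is a unit»,
  NO units-reflection needed) and `isUnit_and_span_eq_of_span_mul_eq_of_span_map_eq`;
* §3 the `k`-POWER pin `pow_eq_and_span_eq_of_span_pow_mul_eq_of_span_map_eq`: in domains `A → B`, «`(k^a·f) = (k^b·g)` in `A`,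
  `(φ f) = (φ g)` in `B`, `φ f ≠ 0`, `φ k` a non-zero NON-unit ⟹ `a = b ∧ (f) = (g)`» — the «⊗ℚ-form + one line ⟹ equality» step
  (an equality of characteristic ideals known up to a power of `p` is PINNED by the equality on one line where `p` stays a
  non-unit), which needs NO units-reflection and NO divisibility;
* §4 the instances on `Λ₂ = ℤ_p⟦T₂⟧⟦T₁⟧ → Λ = ℤ_p⟦T⟧` for BOTH lines (`T₁ ↦ 0`: `PowerSeries.constantCoeff`; `T₂ ↦ 0`:
  `PowerSeries.map PowerSeries.constantCoeff`) with `k := p` (`p` is a non-zero non-unit of `Λ`, `prime_natCast_iwasawaAlgebra`).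
presearch: not applicable (folklore commutative algebra; [cite: Washington1997, §13.2] for the «defined up to units» shape).
beyond-print theorem: no.

References: L. Washington, GTM 83 (1997) §13.2 [Washington1997]; J. Neukirch, A. Schmidt, K. Wingberg (2008) (5.3.9)–(5.3.10)
[NeukirchSchmidtWingberg2008].
-/

set_option autoImplicit false
-- the summit namespace `Summit.BirchSwinnertonDyer.BirchSwinnertonDyer` repeats the problem name by design (D-0017)
set_option linter.dupNamespace false

noncomputable section

namespace Summit.BirchSwinnertonDyer.BirchSwinnertonDyer.Theorems.PrintCf2.LinePin

open Summit.BirchSwinnertonDyer.BirchSwinnertonDyer.Theorems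

/-! ## §1. The ideal-level pin through one units-reflecting specialisation -/

section General

variable {A B : Type*} [CommRing A] [CommRing B]

/-- `(f).map φ = (φ f)` for a principal ideal. [folklore] -/
theorem map_span_singleton (φ : A →+* B) (f : A) :
    (Ideal.span ({f} : Set A)).map φ = Ideal.span {φ f} := by
  rw [Ideal.map_span, Set.image_singleton]

variable [IsDomain B]

/-- **The pin, ideal level.** If `f ∣ g` in `A`, `φ : A → B` reflects units, `B` is a domain, `φ f ≠ 0` and the principal
ideals `(φ f) = (φ g)` agree in `B`, then `(f) = (g)` in `A`. [cite: Washington1997, §13.2 (characteristic power series are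
defined up to units; shape only)] -/
theorem span_singleton_eq_of_dvd_of_span_map_eq (φ : A →+* B) [IsLocalHom φ] {f g : A} (hfg : f ∣ g)
    (hline : Ideal.span ({φ f} : Set B) = Ideal.span {φ g}) (hf0 : φ f ≠ 0) :
    Ideal.span ({f} : Set A) = Ideal.span {g} :=
  DefiniteLineUnitLift.span_singleton_eq_of_associated
    (DefiniteLineUnitLift.associated_of_dvd_of_associated_map φ hfg (mem_nonZeroDivisors_of_ne_zero hf0)
      (Ideal.span_singleton_eq_span_singleton.mp hline))

/-- The same with the line hypothesis in `Ideal.map` form, `(f).map φ = (g).map φ`. [cite: Washington1997, §13.2 (shape only)] -/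
theorem span_singleton_eq_of_dvd_of_map_span_eq (φ : A →+* B) [IsLocalHom φ] {f g : A} (hfg : f ∣ g)
    (hline : (Ideal.span ({f} : Set A)).map φ = (Ideal.span ({g} : Set A)).map φ) (hf0 : φ f ≠ 0) :
    Ideal.span ({f} : Set A) = Ideal.span {g} := by
  rw [map_span_singleton, map_span_singleton] at hline
  exact span_singleton_eq_of_dvd_of_span_map_eq φ hfg hline hf0

/-- Divisibility form of the line hypothesis: `f ∣ g` gives `φ f ∣ φ g` for free, so only the REVERSE divisibility `φ g ∣ φ f`
on the line is an input. [cite: Washington1997, §13.2 (shape only)] -/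
theorem span_singleton_eq_of_dvd_of_map_dvd (φ : A →+* B) [IsLocalHom φ] {f g : A} (hfg : f ∣ g)
    (hline : φ g ∣ φ f) (hf0 : φ f ≠ 0) : Ideal.span ({f} : Set A) = Ideal.span {g} :=
  span_singleton_eq_of_dvd_of_span_map_eq φ hfg
    (le_antisymm (Ideal.span_singleton_le_span_singleton.mpr hline)
      (Ideal.span_singleton_le_span_singleton.mpr (map_dvd φ hfg))) hf0

end General

/-! ## §2. The scalar-defect pin (no units-reflection needed for the defect itself) -/

section Scalar

variable {A B : Type*} [CommRing A] [CommRing B] [IsDomain B]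

/-- **Scalar defect.** If `g ∈ (c·f)` in `A` and, on a specialisation `φ : A → B` into a domain, `φ f ∈ (φ g)` with `φ f ≠ 0`,
then `φ c` is a unit of `B`: `φ f = s·φ r·φ c·φ f`, cancel `φ f`. [cite: Washington1997, §13.2 (shape only)] -/
theorem isUnit_map_of_mem_span_mul_of_mem_span (φ : A →+* B) {c f g : A}
    (hg : g ∈ Ideal.span ({c * f} : Set A)) (hf : φ f ∈ Ideal.span ({φ g} : Set B)) (hf0 : φ f ≠ 0) :
    IsUnit (φ c) := by
  obtain ⟨r, hr⟩ := Ideal.mem_span_singleton'.mp hg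
  obtain ⟨s, hs⟩ := Ideal.mem_span_singleton'.mp hf
  have h1 : (s * φ r * φ c) * φ f = 1 * φ f := by
    rw [one_mul]
    conv_rhs => rw [← hs, ← hr]
    simp only [map_mul]
    ring
  have h2 : s * φ r * φ c = 1 := mul_right_cancel₀ hf0 h1
  exact isUnit_iff_exists_inv.mpr ⟨s * φ r, by rw [mul_comm]; exact h2⟩

/-- **Scalar-defect pin.** `(c·f) = (g)` in `A`, `(φ f) = (φ g)` on a units-reflecting specialisation into a domain with
`φ f ≠ 0` ⟹ `c` is a unit and `(f) = (g)`. [cite: Washington1997, §13.2 (shape only)] -/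
theorem isUnit_and_span_eq_of_span_mul_eq_of_span_map_eq (φ : A →+* B) [IsLocalHom φ] {c f g : A}
    (hA : Ideal.span ({c * f} : Set A) = Ideal.span {g}) (hline : Ideal.span ({φ f} : Set B) = Ideal.span {φ g})
    (hf0 : φ f ≠ 0) : IsUnit c ∧ Ideal.span ({f} : Set A) = Ideal.span {g} := by
  have hg : g ∈ Ideal.span ({c * f} : Set A) := hA ▸ Ideal.mem_span_singleton_self g
  have hf : φ f ∈ Ideal.span ({φ g} : Set B) := hline ▸ Ideal.mem_span_singleton_self (φ f)
  have hc : IsUnit c := IsUnit.of_map φ c (isUnit_map_of_mem_span_mul_of_mem_span φ hg hf hf0)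
  refine ⟨hc, ?_⟩
  rw [← hA, Ideal.span_singleton_mul_left_unit hc]

end Scalar

/-! ## §3. The `k`-power pin: an equality known up to `k^a` is pinned by ONE line on which `k` is a non-unit -/

section Power

variable {A B : Type*} [CommRing A] [CommRing B] [IsDomain B]

/-- In a domain: `(u^a · x) = (u^b · x)` with `x ≠ 0`, `u` a non-zero non-unit ⟹ `a = b`. [folklore] -/
theorem pow_eq_of_span_pow_mul_eq {u x : B} {a b : ℕ} (hx : x ≠ 0) (hu0 : u ≠ 0) (hu : ¬ IsUnit u)
    (h : Ideal.span ({u ^ a * x} : Set B) = Ideal.span {u ^ b * x}) : a = b := by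
  have hassoc : Associated (u ^ a * x) (u ^ b * x) := Ideal.span_singleton_eq_span_singleton.mp h
  -- cancel `x`
  have hab : Associated (u ^ a) (u ^ b) := by
    rw [mul_comm (u ^ a), mul_comm (u ^ b)] at hassoc
    exact Associated.of_mul_left hassoc (Associated.refl x) hx
  by_contra hne
  rcases Nat.lt_or_gt_of_ne hne with hlt | hlt
  · -- `a < b`: `u^a ~ u^a · u^(b-a)` forces `u^(b-a)` to be a unit
    have hsplit : u ^ b = u ^ a * u ^ (b - a) := by rw [← pow_add, Nat.add_sub_cancel' hlt.le]
    rw [hsplit] at hab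
    have h1 : Associated (u ^ a * 1) (u ^ a * u ^ (b - a)) := by rwa [mul_one]
    have hunit : IsUnit (u ^ (b - a)) :=
      associated_one_iff_isUnit.mp (Associated.of_mul_left h1 (Associated.refl _) (pow_ne_zero a hu0)).symm
    exact hu ((isUnit_pow_iff (Nat.sub_ne_zero_of_lt hlt)).mp hunit)
  · have hsplit : u ^ a = u ^ b * u ^ (a - b) := by rw [← pow_add, Nat.add_sub_cancel' hlt.le]
    rw [hsplit] at hab
    have h1 : Associated (u ^ b * u ^ (a - b)) (u ^ b * 1) := by rwa [mul_one]
    have hunit : IsUnit (u ^ (a - b)) :=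
      associated_one_iff_isUnit.mp (Associated.of_mul_left h1 (Associated.refl _) (pow_ne_zero b hu0))
    exact hu ((isUnit_pow_iff (Nat.sub_ne_zero_of_lt hlt)).mp hunit)

variable [IsDomain A]

/-- **The `k`-power pin.** `A → B` a ring map of domains, `(k^a · f) = (k^b · g)` in `A` (an equality «up to a power of `k`»),
`(φ f) = (φ g)` in `B` with `φ f ≠ 0`, and `φ k` a non-zero NON-unit of `B`: then `a = b` and `(f) = (g)` in `A` (`k ≠ 0` in
`A`). No units-reflection and no divisibility hypothesis is needed. [cite: Washington1997, §13.2 (shape only)] -/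
theorem pow_eq_and_span_eq_of_span_pow_mul_eq_of_span_map_eq (φ : A →+* B) {k f g : A} {a b : ℕ} (hk0 : k ≠ 0)
    (hφk0 : φ k ≠ 0) (hφk : ¬ IsUnit (φ k))
    (hA : Ideal.span ({k ^ a * f} : Set A) = Ideal.span {k ^ b * g})
    (hline : Ideal.span ({φ f} : Set B) = Ideal.span {φ g}) (hf0 : φ f ≠ 0) :
    a = b ∧ Ideal.span ({f} : Set A) = Ideal.span {g} := by
  -- transport `hA` to `B` and rewrite `(φ g)` as `(φ f)`
  have hB : Ideal.span ({φ k ^ a * φ f} : Set B) = Ideal.span {φ k ^ b * φ f} := by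
    have h := congrArg (Ideal.map φ) hA
    rw [map_span_singleton, map_span_singleton, map_mul, map_mul, map_pow, map_pow,
      ← Ideal.span_singleton_mul_span_singleton, ← Ideal.span_singleton_mul_span_singleton, ← hline,
      Ideal.span_singleton_mul_span_singleton, Ideal.span_singleton_mul_span_singleton] at h
    exact h
  have hab : a = b := pow_eq_of_span_pow_mul_eq hf0 hφk0 hφk hB
  subst hab
  refine ⟨rfl, ?_⟩
  have hassoc : Associated (k ^ a * f) (k ^ a * g) := Ideal.span_singleton_eq_span_singleton.mp hA
  exact DefiniteLineUnitLift.span_singleton_eq_of_associated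
    (Associated.of_mul_left hassoc (Associated.refl _) (pow_ne_zero a hk0))

end Power

/-! ## §4. The two lines of `Λ₂ = ℤ_p⟦T₂⟧⟦T₁⟧ → Λ = ℤ_p⟦T⟧` with `k := p` -/

section Iwasawa

open Literature.NumberTheory.EllipticCurves

variable {p : ℕ} [Fact p.Prime]

/-- `p ∈ Λ = ℤ_p⟦T⟧` is prime (`p = C p` and the tree's `IwasawaAlgebra.prime_C`).
[cite: NeukirchSchmidtWingberg2008, Ch. V §3, (5.3.9)–(5.3.10)] -/
theorem prime_natCast_iwasawaAlgebra : Prime ((p : ℕ) : IwasawaAlgebra p) := by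
  have h : ((p : ℕ) : IwasawaAlgebra p) = PowerSeries.C ((p : ℕ) : ℤ_[p]) := by rw [map_natCast]
  rw [h]
  exact IwasawaAlgebra.prime_C p

/-- `p` is a non-zero non-unit of `Λ`. [cite: NeukirchSchmidtWingberg2008, Ch. V §3, (5.3.9)–(5.3.10)] -/
theorem natCast_ne_zero_and_not_isUnit_iwasawaAlgebra :
    ((p : ℕ) : IwasawaAlgebra p) ≠ 0 ∧ ¬ IsUnit ((p : ℕ) : IwasawaAlgebra p) :=
  ⟨prime_natCast_iwasawaAlgebra.ne_zero, prime_natCast_iwasawaAlgebra.not_unit⟩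

/-- **Line `T₁ = 0` (the OUTER variable; the `γ₁`-descent `PowerSeries.constantCoeff : Λ₂ → Λ` of the cell's S3b′ push), `p`-power
pin.** `(p^a·f) = (p^b·g)` in `Λ₂` and `(f(0,T₂)) = (g(0,T₂))` in `Λ` with `f(0,T₂) ≠ 0` ⟹ `a = b ∧ (f) = (g)`.
[cite: Washington1997, §13.2 (shape only)] -/
theorem pow_eq_and_span_eq_of_constantCoeff {f g : IwasawaAlgebra₂ p} {a b : ℕ}
    (hA : Ideal.span ({((p : ℕ) : IwasawaAlgebra₂ p) ^ a * f} : Set (IwasawaAlgebra₂ p)) =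
      Ideal.span {((p : ℕ) : IwasawaAlgebra₂ p) ^ b * g})
    (hline : Ideal.span ({PowerSeries.constantCoeff f} : Set (IwasawaAlgebra p)) =
      Ideal.span {PowerSeries.constantCoeff g})
    (hf0 : PowerSeries.constantCoeff f ≠ 0) :
    a = b ∧ Ideal.span ({f} : Set (IwasawaAlgebra₂ p)) = Ideal.span {g} := by
  refine pow_eq_and_span_eq_of_span_pow_mul_eq_of_span_map_eq (PowerSeries.constantCoeff (R := IwasawaAlgebra p))
    FourTerm.prime_natCast_iwasawaAlgebra₂.ne_zero ?_ ?_ hA hline hf0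
  · rw [map_natCast]; exact natCast_ne_zero_and_not_isUnit_iwasawaAlgebra.1
  · rw [map_natCast]; exact natCast_ne_zero_and_not_isUnit_iwasawaAlgebra.2

/-- **Line `T₂ = 0` (the INNER variable; the `γ₂`-descent `PowerSeries.map PowerSeries.constantCoeff : Λ₂ → Λ`), `p`-power pin.**
`(p^a·f) = (p^b·g)` in `Λ₂` and `(f(T₁,0)) = (g(T₁,0))` in `Λ` with `f(T₁,0) ≠ 0` ⟹ `a = b ∧ (f) = (g)`.
[cite: Washington1997, §13.2 (shape only)] -/
theorem pow_eq_and_span_eq_of_mapConstantCoeff {f g : IwasawaAlgebra₂ p} {a b : ℕ}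
    (hA : Ideal.span ({((p : ℕ) : IwasawaAlgebra₂ p) ^ a * f} : Set (IwasawaAlgebra₂ p)) =
      Ideal.span {((p : ℕ) : IwasawaAlgebra₂ p) ^ b * g})
    (hline : Ideal.span ({PowerSeries.map (PowerSeries.constantCoeff (R := ℤ_[p])) f} : Set (IwasawaAlgebra p)) =
      Ideal.span {PowerSeries.map (PowerSeries.constantCoeff (R := ℤ_[p])) g})
    (hf0 : PowerSeries.map (PowerSeries.constantCoeff (R := ℤ_[p])) f ≠ 0) :
    a = b ∧ Ideal.span ({f} : Set (IwasawaAlgebra₂ p)) = Ideal.span {g} := by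
  refine pow_eq_and_span_eq_of_span_pow_mul_eq_of_span_map_eq
    (PowerSeries.map (PowerSeries.constantCoeff (R := ℤ_[p]))) FourTerm.prime_natCast_iwasawaAlgebra₂.ne_zero ?_ ?_ hA hline hf0
  · rw [map_natCast]; exact natCast_ne_zero_and_not_isUnit_iwasawaAlgebra.1
  · rw [map_natCast]; exact natCast_ne_zero_and_not_isUnit_iwasawaAlgebra.2

/-- **Line `T₁ = 0`, divisibility pin (ideal level).** `f ∣ g` in `Λ₂`, `(f(0,T₂)) = (g(0,T₂))` in `Λ`, `f(0,T₂) ≠ 0` ⟹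
`(f) = (g)` (units-reflection = `TwoVarPrimes.isLocalHom_constantCoeff`). [cite: Washington1997, §13.2 (shape only)] -/
theorem span_eq_of_dvd_of_span_constantCoeff_eq {f g : IwasawaAlgebra₂ p} (hfg : f ∣ g)
    (hline : Ideal.span ({PowerSeries.constantCoeff f} : Set (IwasawaAlgebra p)) =
      Ideal.span {PowerSeries.constantCoeff g})
    (hf0 : PowerSeries.constantCoeff f ≠ 0) :
    Ideal.span ({f} : Set (IwasawaAlgebra₂ p)) = Ideal.span {g} :=
  haveI := TwoVarPrimes.isLocalHom_constantCoeff (R := IwasawaAlgebra p)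
  span_singleton_eq_of_dvd_of_span_map_eq _ hfg hline hf0

/-- **Line `T₂ = 0`, divisibility pin (ideal level).** `f ∣ g` in `Λ₂`, `(f(T₁,0)) = (g(T₁,0))` in `Λ`, `f(T₁,0) ≠ 0` ⟹
`(f) = (g)` (units-reflection = `DefiniteLineUnitLift.isLocalHom_mapConstantCoeff`). [cite: Washington1997, §13.2 (shape only)] -/
theorem span_eq_of_dvd_of_span_mapConstantCoeff_eq {f g : IwasawaAlgebra₂ p} (hfg : f ∣ g)
    (hline : Ideal.span ({PowerSeries.map (PowerSeries.constantCoeff (R := ℤ_[p])) f} : Set (IwasawaAlgebra p)) =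
      Ideal.span {PowerSeries.map (PowerSeries.constantCoeff (R := ℤ_[p])) g})
    (hf0 : PowerSeries.map (PowerSeries.constantCoeff (R := ℤ_[p])) f ≠ 0) :
    Ideal.span ({f} : Set (IwasawaAlgebra₂ p)) = Ideal.span {g} :=
  haveI := DefiniteLineUnitLift.isLocalHom_mapConstantCoeff (R := ℤ_[p])
  span_singleton_eq_of_dvd_of_span_map_eq _ hfg hline hf0

end Iwasawa

end Summit.BirchSwinnertonDyer.BirchSwinnertonDyer.Theorems.PrintCf2.LinePin

end
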